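import Literature.MeasureTheory.RestrictedProduct.OrbitalEulerProduct
import Literature.MeasureTheory.Group.InvariantQuotientOrbitalTransport
import Literature.NumberTheory.Automorphic.LocalOrbitalIntegral
import HarnessLib

/-!
# Orbital integrals through a restricted-product model: `Φ(γ, ⊗ f_i) = c · ∏_i Φ(γ_i, f_i)` for a group
# `G_f ≃ₜ* ∏'_i (G_i : K_i)` with local models `ψ_i : G_i ≃ₜ* L_i`
(Gelbart (1975) §9–§10, (9.14)/(10.19); Rogawski (1990) §5.4: `Φ(γ, f) = ∏_v Φ(γ_v, f_v)` for `f = ⊗ f_v`)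

Topic `NumberTheory/Automorphic`; namespace `Literature.NumberTheory.Automorphic`. THEOREMS ONLY (no definition, no instance,
no named fact, no `sorry`). The group-agnostic layer between the tree's restricted-product measure theory
(`Literature/MeasureTheory/RestrictedProduct/OrbitalEulerProduct`: orbital measures on `(∏' G_i) ⧸ C(γ)`) and concrete adelic groups
given with a restricted-product MODEL (e.g. ★ `UnitaryGroup.finAdelicEquiv`, sequel file `UnitaryGroupOrbitalEulerProduct`).

§1 Exact transport of orbital integrals along an isomorphism `e : G ≃* G'` of topological groups with `e γ = γ'`,
for the PUSH-FORWARD measure `(cosetCongr e)_* μ` (no constant — companion of the tree's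
`InvariantQuotientOrbitalTransport`, which compares two given invariant measures up to `c ≠ 0`):
`integral_descConj_map_cosetCongr`, `lintegral_…`, `integrable_…_iff`, the normalisation book-keeping
`map_cosetCongr_apply_image_mk` (`(cosetCongr e)_* μ (π' A') = μ (π (e⁻¹ A'))`), and the admissibility fields
(`isFiniteMeasureOnCompacts_map_cosetCongr`, `map_cosetCongr_ne_zero`; invariance is ★
`smulInvariantMeasure_map_cosetCongr_of_smulInvariant`).

§2 GENERIC: a topological group `G_f` with a restricted-product model `e : G_f ≃ₜ* ∏'_i (G_i : K_i)` (compact open `K_i`,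
second countable locally compact `G_i`) and local models `ψ_i : G_i ≃ₜ* L_i`; `γ ∈ G_f` with local components `γloc i`
(`ψ_i((e γ)_i) = γloc i`); ANY non-zero invariant Borel measure `μ` on `G_f ⧸ C(γ)` finite on compacta and local invariant `m_i`
on `L_i ⧸ C(γloc i)` finite on compacta with `m_i(π ψ_i K_i) = 1` off `S₀`, `m_i ≠ 0` on `S₀`:
* **`exists_orbitalIntegral_eq_smul_prod_of_continuousMulEquiv`** (stabilised form) — ONE `c ≠ 0` with
  `orbitalIntegral γ F μ = c · ∏_{i∈S₂} orbitalIntegral (γloc i) (f i) (m i)` for every pure tensor `F` with `μ`-integrable orbital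
  integrand whose local orbital integrals are `1` off `S₂`;
* **`exists_tendsto_prod_orbitalIntegral_of_continuousMulEquiv`** (convergence form, no unramified computation) —
  `∏_{i∈T} orbitalIntegral (γloc i) (f i) (m i) ⟶ c⁻¹ · orbitalIntegral γ F μ`.
Proof: transport `μ` along `e` and each `m_i` along `ψ_i` (§1), then ★ `RestrictedProduct/OrbitalEulerProduct` (uniqueness of
invariant measures on `(∏' G_i) ⧸ C(e γ) ≃ₜ ∏' G_i ⧸ C((e γ)_i)` against `∏'(m_i ; π_i K_i)` + Tate's Thm 3.3.1).
Written for the cell `pub/hodgecm-mathlib`, ENGINE T1 line `F0_T1InnerFormTraceIdentity`, plan O13c-Q3 / PLAN-T1 (g2) O2.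
HC_CM is proved only modulo the printed citations until rung 0 closes; this file is unconditional.

## References

* S. Gelbart, *Automorphic forms on adele groups*, Ann. of Math. Stud. 83 (1975), (9.13)–(9.14), p. 155 (10.19) [Gelbart1975].
* J. D. Rogawski, *Automorphic Representations of Unitary Groups in Three Variables* (1990), §5.4 p. 72 [Rogawski1990].
* A. Borel, H. Jacquet, *Automorphic forms and automorphic representations*, PSPM 33.1 (1979), §4.1 [BorelJacquet1979].
-/

noncomputable section

open MeasureTheory Measure Set Filter Topology NumberField IsDedekindDomain
open Literature.MeasureTheory.Group Literature.MeasureTheory.RestrictedProduct Literature.Topology.RestrictedProduct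
open scoped ENNReal NNReal RestrictedProduct

namespace Literature.NumberTheory.Automorphic

/-! ## §1 Exact transport of orbital integrals along `cosetCongr e` (push-forward measure) -/

section Transport

variable {G G' : Type*} [Group G] [Group G'] [TopologicalSpace G] [TopologicalSpace G']
  (e : G ≃* G') (he : Continuous e) (hes : Continuous e.symm) {γ : G} {γ' : G'} (hγ : e γ = γ')
  [MeasurableSpace (G ⧸ Subgroup.centralizer ({γ} : Set G))] [BorelSpace (G ⧸ Subgroup.centralizer ({γ} : Set G))]
  [MeasurableSpace (G' ⧸ Subgroup.centralizer ({γ'} : Set G'))]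
  [BorelSpace (G' ⧸ Subgroup.centralizer ({γ'} : Set G'))]
  (μ : Measure (G ⧸ Subgroup.centralizer ({γ} : Set G)))

include he hes in
/-- `(cosetCongr e)_* μ (A) = μ ((cosetCongr e)⁻¹' A)` for EVERY set `A` (`cosetCongr e` is a homeomorphism, hence a
measurable equivalence). [cite: Gelbart1975, (9.13)] -/
theorem map_cosetCongr_apply' (A : Set (G' ⧸ Subgroup.centralizer ({γ'} : Set G'))) :
    μ.map (cosetCongr e _ _ (forall_apply_mem_centralizer_singleton_iff_of_eq e hγ)) A =
      μ (cosetCongr e _ _ (forall_apply_mem_centralizer_singleton_iff_of_eq e hγ) ⁻¹' A) := by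
  rw [← coe_cosetCongrHomeomorph e _ _ _ he hes, ← Homeomorph.toMeasurableEquiv_coe, MeasurableEquiv.map_apply]

omit [TopologicalSpace G] [TopologicalSpace G'] [MeasurableSpace (G ⧸ Subgroup.centralizer ({γ} : Set G))]
  [BorelSpace (G ⧸ Subgroup.centralizer ({γ} : Set G))] [MeasurableSpace (G' ⧸ Subgroup.centralizer ({γ'} : Set G'))]
  [BorelSpace (G' ⧸ Subgroup.centralizer ({γ'} : Set G'))] in
/-- **Normalisation book-keeping**: the preimage under `cosetCongr e` of the image `π'(A')` of a subset `A' ⊆ G'` is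
the image `π(e⁻¹ A')`. [cite: Gelbart1975, (9.13)] -/
theorem preimage_cosetCongr_image_mk (A' : Set G') :
    cosetCongr e _ _ (forall_apply_mem_centralizer_singleton_iff_of_eq e hγ) ⁻¹'
        ((QuotientGroup.mk : G' → G' ⧸ Subgroup.centralizer ({γ'} : Set G')) '' A') =
      (QuotientGroup.mk : G → G ⧸ Subgroup.centralizer ({γ} : Set G)) '' (e ⁻¹' A') := by
  ext x
  induction x using QuotientGroup.induction_on with
  | H g =>
    simp only [mem_preimage, cosetCongr_mk, mem_image]
    constructor
    · rintro ⟨a', ha', h⟩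
      refine ⟨e.symm a', by simpa using ha', ?_⟩
      rw [QuotientGroup.eq] at h ⊢
      rw [← forall_apply_mem_centralizer_singleton_iff_of_eq e hγ, map_mul, map_inv, MulEquiv.apply_symm_apply]
      exact h
    · rintro ⟨a, ha, h⟩
      refine ⟨e a, ha, ?_⟩
      rw [QuotientGroup.eq] at h ⊢
      rw [← map_inv, ← map_mul]
      exact (forall_apply_mem_centralizer_singleton_iff_of_eq e hγ _).2 h

include he hes in
/-- `(cosetCongr e)_* μ (π' A') = μ (π (e⁻¹ A'))` — e.g. the normalisation `m(π K) = 1` transports along level-matching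
isomorphisms. [cite: Gelbart1975, (9.13)] -/
theorem map_cosetCongr_apply_image_mk (A' : Set G') :
    μ.map (cosetCongr e _ _ (forall_apply_mem_centralizer_singleton_iff_of_eq e hγ))
        ((QuotientGroup.mk : G' → G' ⧸ Subgroup.centralizer ({γ'} : Set G')) '' A') =
      μ ((QuotientGroup.mk : G → G ⧸ Subgroup.centralizer ({γ} : Set G)) '' (e ⁻¹' A')) := by
  rw [map_cosetCongr_apply' e he hes hγ, preimage_cosetCongr_image_mk e hγ]

include he hes in
/-- **Exact transport of orbital integrals** (Bochner): `∫ F(y γ' y⁻¹) d((cosetCongr e)_* μ)(y) = ∫ F(e(x γ x⁻¹)) dμ(x)` —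
change of variables along the measurable equivalence `cosetCongr e` and `descConj_cosetCongr_apply`; no constant,
no integrability hypothesis. [cite: Gelbart1975, (9.13)] -/
theorem integral_descConj_map_cosetCongr {E : Type*} [NormedAddCommGroup E] [NormedSpace ℝ E] (F : G' → E) :
    ∫ y, descConj γ' (Subgroup.centralizer ({γ'} : Set G')) (centralizer_comm γ') F y
        ∂μ.map (cosetCongr e _ _ (forall_apply_mem_centralizer_singleton_iff_of_eq e hγ)) =
      ∫ x, descConj γ (Subgroup.centralizer ({γ} : Set G)) (centralizer_comm γ) (F ∘ e) x ∂μ := by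
  rw [← coe_cosetCongrHomeomorph e _ _ _ he hes, ← Homeomorph.toMeasurableEquiv_coe, integral_map_equiv]
  refine integral_congr_ae (Eventually.of_forall fun x => ?_)
  exact descConj_cosetCongr_apply e hγ F x

include he hes in
/-- The `[0, ∞]`-valued twin of `integral_descConj_map_cosetCongr`. [cite: Gelbart1975, (9.13)] -/
theorem lintegral_descConj_map_cosetCongr (F : G' → ℝ≥0∞) :
    ∫⁻ y, descConj γ' (Subgroup.centralizer ({γ'} : Set G')) (centralizer_comm γ') F y
        ∂μ.map (cosetCongr e _ _ (forall_apply_mem_centralizer_singleton_iff_of_eq e hγ)) =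
      ∫⁻ x, descConj γ (Subgroup.centralizer ({γ} : Set G)) (centralizer_comm γ) (F ∘ e) x ∂μ := by
  rw [← coe_cosetCongrHomeomorph e _ _ _ he hes, ← Homeomorph.toMeasurableEquiv_coe, lintegral_map_equiv]
  refine lintegral_congr fun x => ?_
  exact descConj_cosetCongr_apply e hγ F x

include he hes in
/-- Integrability of orbital integrands transports exactly along `cosetCongr e`. [cite: Gelbart1975, (9.13)] -/
theorem integrable_descConj_map_cosetCongr_iff {E : Type*} [NormedAddCommGroup E] (F : G' → E) :
    Integrable (descConj γ' (Subgroup.centralizer ({γ'} : Set G')) (centralizer_comm γ') F)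
        (μ.map (cosetCongr e _ _ (forall_apply_mem_centralizer_singleton_iff_of_eq e hγ))) ↔
      Integrable (descConj γ (Subgroup.centralizer ({γ} : Set G)) (centralizer_comm γ) (F ∘ e)) μ := by
  rw [← coe_cosetCongrHomeomorph e _ _ _ he hes, ← Homeomorph.toMeasurableEquiv_coe, integrable_map_equiv]
  have h : descConj γ' (Subgroup.centralizer ({γ'} : Set G')) (centralizer_comm γ') F ∘
      ⇑(cosetCongrHomeomorph e _ _ (forall_apply_mem_centralizer_singleton_iff_of_eq e hγ) he hes).toMeasurableEquiv =
      descConj γ (Subgroup.centralizer ({γ} : Set G)) (centralizer_comm γ) (F ∘ e) :=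
    funext fun x => descConj_cosetCongr_apply e hγ F x
  rw [h]

include he hes in
/-- `(cosetCongr e)_* μ` is finite on compacta when `μ` is. [cite: Gelbart1975, (9.13)] -/
theorem isFiniteMeasureOnCompacts_map_cosetCongr [IsFiniteMeasureOnCompacts μ] :
    IsFiniteMeasureOnCompacts (μ.map (cosetCongr e _ _ (forall_apply_mem_centralizer_singleton_iff_of_eq e hγ))) := by
  rw [← coe_cosetCongrHomeomorph e _ _ _ he hes]
  exact IsFiniteMeasureOnCompacts.map μ _

include he in
/-- `(cosetCongr e)_* μ ≠ 0` iff `μ ≠ 0`. [cite: Gelbart1975, (9.13)] -/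
theorem map_cosetCongr_ne_zero (hμ : μ ≠ 0) :
    μ.map (cosetCongr e _ _ (forall_apply_mem_centralizer_singleton_iff_of_eq e hγ)) ≠ 0 := by
  rw [Ne, Measure.map_eq_zero_iff
    ((continuous_cosetCongr e _ _ (forall_apply_mem_centralizer_singleton_iff_of_eq e hγ) he).measurable).aemeasurable]
  exact hμ

end Transport

/-! ## §2 Generic: a group `G_f ≃ₜ* ∏'_i (G_i : K_i)` with local models `ψ_i : G_i ≃ₜ* L_i` -/

section Generic

variable {ι : Type} [Countable ι] {G : ι → Type} [∀ i, Group (G i)] [∀ i, TopologicalSpace (G i)]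
  [∀ i, IsTopologicalGroup (G i)] [∀ i, SecondCountableTopology (G i)] [∀ i, T2Space (G i)]
  [∀ i, LocallyCompactSpace (G i)]
  (K : ∀ i, Subgroup (G i)) [hKo : Fact (∀ i, IsOpen (K i : Set (G i)))] [hKc : ∀ i, CompactSpace (K i)]
  {Lc : ι → Type} [∀ i, Group (Lc i)] [∀ i, TopologicalSpace (Lc i)]
  (ψ : ∀ i, G i ≃ₜ* Lc i)
  {Gf : Type} [Group Gf] [TopologicalSpace Gf]
  (e : Gf ≃ₜ* (Πʳ i, [G i, K i])) (γ : Gf) (γloc : ∀ i, Lc i) (hγloc : ∀ i, ψ i (e γ i) = γloc i)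
  [MeasurableSpace (Gf ⧸ Subgroup.centralizer ({γ} : Set Gf))] [BorelSpace (Gf ⧸ Subgroup.centralizer ({γ} : Set Gf))]
  (μ : Measure (Gf ⧸ Subgroup.centralizer ({γ} : Set Gf)))
  [SMulInvariantMeasure Gf (Gf ⧸ Subgroup.centralizer ({γ} : Set Gf)) μ] [IsFiniteMeasureOnCompacts μ]
  [∀ i, MeasurableSpace (Lc i ⧸ Subgroup.centralizer ({γloc i} : Set (Lc i)))]
  [∀ i, BorelSpace (Lc i ⧸ Subgroup.centralizer ({γloc i} : Set (Lc i)))]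
  (m : ∀ i, Measure (Lc i ⧸ Subgroup.centralizer ({γloc i} : Set (Lc i))))
  [∀ i, SMulInvariantMeasure (Lc i) (Lc i ⧸ Subgroup.centralizer ({γloc i} : Set (Lc i))) (m i)]
  [∀ i, IsFiniteMeasureOnCompacts (m i)]

include hγloc in
/-- **Euler product of orbital integrals through a restricted-product model (scalar, stabilised form).** Let
`e : G_f ≃ₜ* ∏'_i (G_i : K_i)` (compact open `K_i`, locally compact second countable `G_i`) and local models
`ψ_i : G_i ≃ₜ* L_i`; let `γ ∈ G_f` with local components `γ_i = ψ_i((e γ)_i) ∈ L_i` (given as a family `γloc` with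
`ψ_i((e γ)_i) = γloc i`, so that consumers may name them as they please); `μ ≠ 0` a `G_f`-invariant Borel
measure on `G_f ⧸ C(γ)` finite on compacta; `m_i` invariant Borel measures on `L_i ⧸ C(γ_i)` finite on compacta with
`m_i(π_i ψ_i(K_i)) = 1` off `S₀` and `m_i ≠ 0` on `S₀`. Then there is ONE `c ≠ 0` such that for every pure tensor
`F(b) = ∏_{i∈S} f_i(ψ_i (e b)_i)` (on `(e b)_i ∈ K_i` off `S`, all `S ⊇ S₁ ⊇ S₀ ∪ S_γ`) with `μ`-integrable orbital integrand
and local orbital integrals `orbitalIntegral γ_i f_i m_i = 1` off a finite `S₂`: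
`orbitalIntegral γ F μ = c · ∏_{i∈S₂} orbitalIntegral γ_i f_i m_i`. [cite: Gelbart1975, p. 155 (10.19)] -/
theorem exists_orbitalIntegral_eq_smul_prod_of_continuousMulEquiv (hμ : μ ≠ 0) {S₀ : Finset ι}
    (hm1 : ∀ i, i ∉ S₀ → m i ((QuotientGroup.mk : Lc i → _) '' (⇑(ψ i).symm ⁻¹' (K i : Set (G i)))) = 1)
    (hm : ∀ i, i ∈ S₀ → m i ≠ 0) :
    ∃ c : ℝ≥0, c ≠ 0 ∧ ∀ (f : ∀ i, Lc i → ℂ) (F : Gf → ℂ) (S₁ S₂ : Finset ι),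
      (∀ S : Finset ι, S₁ ⊆ S → ∀ b : Gf, (∀ i, i ∉ S → e b i ∈ K i) → F b = ∏ i ∈ S, f i (ψ i (e b i))) →
      (∀ i, i ∉ S₁ → e γ i ∈ K i) → S₀ ⊆ S₁ →
      Integrable (descConj γ (Subgroup.centralizer ({γ} : Set Gf)) (centralizer_comm γ) F) μ →
      (∀ i, i ∉ S₂ → orbitalIntegral (γloc i) (f i) (m i) = 1) →
        orbitalIntegral γ F μ = c • ∏ i ∈ S₂, orbitalIntegral (γloc i) (f i) (m i) := by
  classical
  -- the adelic point on the restricted product and its local components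
  have hγ' : e.toMulEquiv γ = e γ := rfl
  have hγv : ∀ i, (ψ i).symm.toMulEquiv (γloc i) = e γ i := fun i => by
    rw [← hγloc i]
    exact (ψ i).symm_apply_apply (e γ i)
  -- Borel structures on the model orbit spaces
  letI : ∀ i, MeasurableSpace (G i ⧸ Subgroup.centralizer ({e γ i} : Set (G i))) := fun i => borel _
  haveI : ∀ i, BorelSpace (G i ⧸ Subgroup.centralizer ({e γ i} : Set (G i))) := fun i => ⟨rfl⟩
  letI : MeasurableSpace ((Πʳ i, [G i, K i]) ⧸ Subgroup.centralizer ({e γ} : Set (Πʳ i, [G i, K i]))) := borel _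
  haveI : BorelSpace ((Πʳ i, [G i, K i]) ⧸ Subgroup.centralizer ({e γ} : Set (Πʳ i, [G i, K i]))) := ⟨rfl⟩
  -- transported local measures
  let m' : ∀ i, Measure (G i ⧸ Subgroup.centralizer ({e γ i} : Set (G i))) := fun i =>
    (m i).map (cosetCongr (ψ i).symm.toMulEquiv _ (Subgroup.centralizer ({e γ i} : Set (G i)))
      (forall_apply_mem_centralizer_singleton_iff_of_eq _ (hγv i)))
  haveI : ∀ i, SMulInvariantMeasure (G i) (G i ⧸ Subgroup.centralizer ({e γ i} : Set (G i))) (m' i) :=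
    fun i => smulInvariantMeasure_map_cosetCongr_of_smulInvariant (ψ i).symm.toMulEquiv
      (ψ i).symm.continuous _ (Subgroup.centralizer ({e γ i} : Set (G i)))
      (forall_apply_mem_centralizer_singleton_iff_of_eq _ (hγv i)) (m i)
  haveI : ∀ i, IsFiniteMeasureOnCompacts (m' i) := fun i =>
    isFiniteMeasureOnCompacts_map_cosetCongr (ψ i).symm.toMulEquiv (ψ i).symm.continuous
      (ψ i).continuous (hγv i) (m i)
  haveI : ∀ i, SigmaFinite (m' i) := fun i => by
    haveI : IsLocallyFiniteMeasure (m' i) := isLocallyFiniteMeasure_of_isFiniteMeasureOnCompacts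
    exact sigmaFinite_of_locallyFinite
  have hm1' : ∀ i, i ∉ S₀ → m' i (quotBase K (fun i => Subgroup.centralizer ({e γ i} : Set (G i))) i) = 1 := by
    intro i hi
    change (m i).map _ ((QuotientGroup.mk : G i → _) '' (K i : Set (G i))) = 1
    rw [map_cosetCongr_apply_image_mk (ψ i).symm.toMulEquiv (ψ i).symm.continuous (ψ i).continuous (hγv i)]
    exact hm1 i hi
  have hm' : ∀ i, i ∈ S₀ → m' i ≠ 0 := fun i hi =>
    map_cosetCongr_ne_zero (ψ i).symm.toMulEquiv (ψ i).symm.continuous (hγv i) (m i) (hm i hi)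
  -- transported global measure
  let μ' : Measure ((Πʳ i, [G i, K i]) ⧸ Subgroup.centralizer ({e γ} : Set (Πʳ i, [G i, K i]))) :=
    μ.map (cosetCongr e.toMulEquiv _ (Subgroup.centralizer ({e γ} : Set (Πʳ i, [G i, K i])))
      (forall_apply_mem_centralizer_singleton_iff_of_eq _ hγ'))
  haveI : SMulInvariantMeasure (Πʳ i, [G i, K i])
      ((Πʳ i, [G i, K i]) ⧸ Subgroup.centralizer ({e γ} : Set (Πʳ i, [G i, K i]))) μ' :=
    smulInvariantMeasure_map_cosetCongr_of_smulInvariant e.toMulEquiv e.continuous _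
      (Subgroup.centralizer ({e γ} : Set (Πʳ i, [G i, K i]))) (forall_apply_mem_centralizer_singleton_iff_of_eq _ hγ') μ
  haveI : IsFiniteMeasureOnCompacts μ' :=
    isFiniteMeasureOnCompacts_map_cosetCongr e.toMulEquiv e.continuous e.symm.continuous hγ' μ
  have hμ' : μ' ≠ 0 := map_cosetCongr_ne_zero e.toMulEquiv e.continuous hγ' μ hμ
  -- the generic Euler product on the restricted product
  obtain ⟨c, hc0, hc⟩ := exists_integral_descConj_eq_smul_prod K (e γ) μ' m' hμ' hm1' hm'
  refine ⟨c, hc0, fun f F S₁ S₂ hF hγS hS₀ hFi hf1 => ?_⟩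
  -- hypotheses on the restricted-product side
  have hF' : ∀ S : Finset ι, S₁ ⊆ S → ∀ x : Πʳ i, [G i, K i], (∀ i, i ∉ S → x i ∈ (K i : Set (G i))) →
      (F ∘ e.symm) x = ∏ i ∈ S, (f i ∘ ψ i) (x i) := by
    intro S hS x hx
    have hx' : ∀ i, i ∉ S → e (e.symm x) i ∈ K i := fun i hi => by
      rw [ContinuousMulEquiv.apply_symm_apply]
      exact hx i hi
    rw [Function.comp_apply, hF S hS _ hx']
    refine Finset.prod_congr rfl fun i _ => ?_
    rw [Function.comp_apply, ContinuousMulEquiv.apply_symm_apply]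
  have hFi' : Integrable (descConj (e γ) (Subgroup.centralizer ({e γ} : Set (Πʳ i, [G i, K i]))) (centralizer_comm (e γ))
      (F ∘ e.symm)) μ' := by
    rw [integrable_descConj_map_cosetCongr_iff e.toMulEquiv e.continuous e.symm.continuous hγ']
    have hcomp : (F ∘ e.symm) ∘ ⇑e.toMulEquiv = F := funext fun b => by
      show F (e.symm (e b)) = F b
      rw [ContinuousMulEquiv.symm_apply_apply]
    rw [hcomp]
    exact hFi
  -- the local orbital integrals agree
  have hlocal : ∀ i, ∫ y, descConj (e γ i) (Subgroup.centralizer ({e γ i} : Set (G i))) (centralizer_comm (e γ i))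
      (f i ∘ ψ i) y ∂(m' i) = orbitalIntegral (γloc i) (f i) (m i) := by
    intro i
    change ∫ y, _ ∂(m i).map _ = _
    rw [integral_descConj_map_cosetCongr (ψ i).symm.toMulEquiv (ψ i).symm.continuous (ψ i).continuous (hγv i)]
    have hcomp : (f i ∘ ψ i) ∘ ⇑(ψ i).symm.toMulEquiv = f i := funext fun y => by
      show f i (ψ i ((ψ i).symm y)) = f i y
      rw [ContinuousMulEquiv.apply_symm_apply]
    rw [hcomp]
    rfl
  have hf1' : ∀ i, i ∉ S₂ → ∫ y, descConj (e γ i) (Subgroup.centralizer ({e γ i} : Set (G i)))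
      (centralizer_comm (e γ i)) (f i ∘ ψ i) y ∂(m' i) = 1 := fun i hi => by
    rw [hlocal i]; exact hf1 i hi
  -- the global orbital integrals agree
  have hglobal : ∫ y, descConj (e γ) (Subgroup.centralizer ({e γ} : Set (Πʳ i, [G i, K i]))) (centralizer_comm (e γ))
      (F ∘ e.symm) y ∂μ' = orbitalIntegral γ F μ := by
    change ∫ y, _ ∂μ.map _ = _
    rw [integral_descConj_map_cosetCongr e.toMulEquiv e.continuous e.symm.continuous hγ']
    have hcomp : (F ∘ e.symm) ∘ ⇑e.toMulEquiv = F := funext fun b => by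
      show F (e.symm (e b)) = F b
      rw [ContinuousMulEquiv.symm_apply_apply]
    rw [hcomp]
    rfl
  have key := hc (fun i => f i ∘ ψ i) (F ∘ e.symm) S₁ S₂ hF' hγS hS₀ hFi' hf1'
  rw [hglobal] at key
  rw [key]
  exact congrArg _ (Finset.prod_congr rfl fun i _ => hlocal i)

include hγloc in
/-- **Euler product through a restricted-product model, convergence form** (no unramified computation needed): with
ONE `c ≠ 0`, for every scalar pure tensor `F` with `μ`-integrable orbital integrand the partial products of the local orbital
integrals converge, `∏_{i∈T} orbitalIntegral γ_i f_i m_i ⟶ c⁻¹ · orbitalIntegral γ F μ` as `T ↑` — the form in which two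
groups with matching local orbital integrals are compared place by place. [cite: Gelbart1975, p. 155 (10.19)] -/
theorem exists_tendsto_prod_orbitalIntegral_of_continuousMulEquiv (hμ : μ ≠ 0) {S₀ : Finset ι}
    (hm1 : ∀ i, i ∉ S₀ → m i ((QuotientGroup.mk : Lc i → _) '' (⇑(ψ i).symm ⁻¹' (K i : Set (G i)))) = 1)
    (hm : ∀ i, i ∈ S₀ → m i ≠ 0) :
    ∃ c : ℝ≥0, c ≠ 0 ∧ ∀ (f : ∀ i, Lc i → ℂ) (F : Gf → ℂ) (S₁ : Finset ι),
      (∀ S : Finset ι, S₁ ⊆ S → ∀ b : Gf, (∀ i, i ∉ S → e b i ∈ K i) → F b = ∏ i ∈ S, f i (ψ i (e b i))) →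
      (∀ i, i ∉ S₁ → e γ i ∈ K i) → S₀ ⊆ S₁ →
      Integrable (descConj γ (Subgroup.centralizer ({γ} : Set Gf)) (centralizer_comm γ) F) μ →
        Tendsto (fun T : Finset ι => ∏ i ∈ T, orbitalIntegral (γloc i) (f i) (m i)) atTop
          (𝓝 (((c : ℝ)⁻¹) • orbitalIntegral γ F μ)) := by
  classical
  have hγ' : e.toMulEquiv γ = e γ := rfl
  have hγv : ∀ i, (ψ i).symm.toMulEquiv (γloc i) = e γ i := fun i => by
    rw [← hγloc i]
    exact (ψ i).symm_apply_apply (e γ i)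
  letI : ∀ i, MeasurableSpace (G i ⧸ Subgroup.centralizer ({e γ i} : Set (G i))) := fun i => borel _
  haveI : ∀ i, BorelSpace (G i ⧸ Subgroup.centralizer ({e γ i} : Set (G i))) := fun i => ⟨rfl⟩
  letI : MeasurableSpace ((Πʳ i, [G i, K i]) ⧸ Subgroup.centralizer ({e γ} : Set (Πʳ i, [G i, K i]))) := borel _
  haveI : BorelSpace ((Πʳ i, [G i, K i]) ⧸ Subgroup.centralizer ({e γ} : Set (Πʳ i, [G i, K i]))) := ⟨rfl⟩
  let m' : ∀ i, Measure (G i ⧸ Subgroup.centralizer ({e γ i} : Set (G i))) := fun i =>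
    (m i).map (cosetCongr (ψ i).symm.toMulEquiv _ (Subgroup.centralizer ({e γ i} : Set (G i)))
      (forall_apply_mem_centralizer_singleton_iff_of_eq _ (hγv i)))
  haveI : ∀ i, SMulInvariantMeasure (G i) (G i ⧸ Subgroup.centralizer ({e γ i} : Set (G i))) (m' i) :=
    fun i => smulInvariantMeasure_map_cosetCongr_of_smulInvariant (ψ i).symm.toMulEquiv
      (ψ i).symm.continuous _ (Subgroup.centralizer ({e γ i} : Set (G i)))
      (forall_apply_mem_centralizer_singleton_iff_of_eq _ (hγv i)) (m i)
  haveI : ∀ i, IsFiniteMeasureOnCompacts (m' i) := fun i =>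
    isFiniteMeasureOnCompacts_map_cosetCongr (ψ i).symm.toMulEquiv (ψ i).symm.continuous
      (ψ i).continuous (hγv i) (m i)
  haveI : ∀ i, SigmaFinite (m' i) := fun i => by
    haveI : IsLocallyFiniteMeasure (m' i) := isLocallyFiniteMeasure_of_isFiniteMeasureOnCompacts
    exact sigmaFinite_of_locallyFinite
  have hm1' : ∀ i, i ∉ S₀ → m' i (quotBase K (fun i => Subgroup.centralizer ({e γ i} : Set (G i))) i) = 1 := by
    intro i hi
    change (m i).map _ ((QuotientGroup.mk : G i → _) '' (K i : Set (G i))) = 1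
    rw [map_cosetCongr_apply_image_mk (ψ i).symm.toMulEquiv (ψ i).symm.continuous (ψ i).continuous (hγv i)]
    exact hm1 i hi
  have hm' : ∀ i, i ∈ S₀ → m' i ≠ 0 := fun i hi =>
    map_cosetCongr_ne_zero (ψ i).symm.toMulEquiv (ψ i).symm.continuous (hγv i) (m i) (hm i hi)
  let μ' : Measure ((Πʳ i, [G i, K i]) ⧸ Subgroup.centralizer ({e γ} : Set (Πʳ i, [G i, K i]))) :=
    μ.map (cosetCongr e.toMulEquiv _ (Subgroup.centralizer ({e γ} : Set (Πʳ i, [G i, K i])))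
      (forall_apply_mem_centralizer_singleton_iff_of_eq _ hγ'))
  haveI : SMulInvariantMeasure (Πʳ i, [G i, K i])
      ((Πʳ i, [G i, K i]) ⧸ Subgroup.centralizer ({e γ} : Set (Πʳ i, [G i, K i]))) μ' :=
    smulInvariantMeasure_map_cosetCongr_of_smulInvariant e.toMulEquiv e.continuous _
      (Subgroup.centralizer ({e γ} : Set (Πʳ i, [G i, K i]))) (forall_apply_mem_centralizer_singleton_iff_of_eq _ hγ') μ
  haveI : IsFiniteMeasureOnCompacts μ' :=
    isFiniteMeasureOnCompacts_map_cosetCongr e.toMulEquiv e.continuous e.symm.continuous hγ' μ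
  have hμ' : μ' ≠ 0 := map_cosetCongr_ne_zero e.toMulEquiv e.continuous hγ' μ hμ
  obtain ⟨c, hc0, hc⟩ := exists_tendsto_prod_integral_descConj K (e γ) μ' m' hμ' hm1' hm'
  refine ⟨c, hc0, fun f F S₁ hF hγS hS₀ hFi => ?_⟩
  have hF' : ∀ S : Finset ι, S₁ ⊆ S → ∀ x : Πʳ i, [G i, K i], (∀ i, i ∉ S → x i ∈ (K i : Set (G i))) →
      (F ∘ e.symm) x = ∏ i ∈ S, (f i ∘ ψ i) (x i) := by
    intro S hS x hx
    have hx' : ∀ i, i ∉ S → e (e.symm x) i ∈ K i := fun i hi => by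
      rw [ContinuousMulEquiv.apply_symm_apply]
      exact hx i hi
    rw [Function.comp_apply, hF S hS _ hx']
    refine Finset.prod_congr rfl fun i _ => ?_
    rw [Function.comp_apply, ContinuousMulEquiv.apply_symm_apply]
  have hFi' : Integrable (descConj (e γ) (Subgroup.centralizer ({e γ} : Set (Πʳ i, [G i, K i]))) (centralizer_comm (e γ))
      (F ∘ e.symm)) μ' := by
    rw [integrable_descConj_map_cosetCongr_iff e.toMulEquiv e.continuous e.symm.continuous hγ']
    have hcomp : (F ∘ e.symm) ∘ ⇑e.toMulEquiv = F := funext fun b => by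
      show F (e.symm (e b)) = F b
      rw [ContinuousMulEquiv.symm_apply_apply]
    rw [hcomp]
    exact hFi
  have hlocal : ∀ i, ∫ y, descConj (e γ i) (Subgroup.centralizer ({e γ i} : Set (G i))) (centralizer_comm (e γ i))
      (f i ∘ ψ i) y ∂(m' i) = orbitalIntegral (γloc i) (f i) (m i) := by
    intro i
    change ∫ y, _ ∂(m i).map _ = _
    rw [integral_descConj_map_cosetCongr (ψ i).symm.toMulEquiv (ψ i).symm.continuous (ψ i).continuous (hγv i)]
    have hcomp : (f i ∘ ψ i) ∘ ⇑(ψ i).symm.toMulEquiv = f i := funext fun y => by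
      show f i (ψ i ((ψ i).symm y)) = f i y
      rw [ContinuousMulEquiv.apply_symm_apply]
    rw [hcomp]
    rfl
  have hglobal : ∫ y, descConj (e γ) (Subgroup.centralizer ({e γ} : Set (Πʳ i, [G i, K i]))) (centralizer_comm (e γ))
      (F ∘ e.symm) y ∂μ' = orbitalIntegral γ F μ := by
    change ∫ y, _ ∂μ.map _ = _
    rw [integral_descConj_map_cosetCongr e.toMulEquiv e.continuous e.symm.continuous hγ']
    have hcomp : (F ∘ e.symm) ∘ ⇑e.toMulEquiv = F := funext fun b => by
      show F (e.symm (e b)) = F b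
      rw [ContinuousMulEquiv.symm_apply_apply]
    rw [hcomp]
    rfl
  have key := hc (fun i => f i ∘ ψ i) (F ∘ e.symm) S₁ hF' hγS hS₀ hFi'
  rw [hglobal] at key
  have hfun : (fun T : Finset ι => ∏ i ∈ T, ∫ y, descConj (e γ i) (Subgroup.centralizer ({e γ i} : Set (G i)))
      (centralizer_comm (e γ i)) (f i ∘ ψ i) y ∂(m' i)) =
      fun T : Finset ι => ∏ i ∈ T, orbitalIntegral (γloc i) (f i) (m i) :=
    funext fun T => Finset.prod_congr rfl fun i _ => hlocal i
  rw [hfun] at key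
  exact key

end Generic

end Literature.NumberTheory.Automorphic

end
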